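import Summits.Ventures.CertifiedManyBodySolver.Downfold.BoxReadPinnedPairTPrime
import Summits.Ventures.CertifiedManyBodySolver.Downfold.BoxesLa214V115M2cKernelPairCloser
import HarnessLib

/-!
# The pinned `t′`-pair ⟹ bundle row AT A GIVEN WINDOW, with the floor KIND of the boxdual law as ONE DECIDABLE DISJUNCTION
# (route-independent home of the «of_kind» step used by the literal-generic pair-shape closers)

Venture CertifiedManyBodySolver; cell `hubbard-obs` × `hubbard-downfold` (D-0154 (1)(C) COVERAGE NdNiO₂); seat `hubbard-cov-ndnio2-unc-3` (g7,
`prover-hubbard-cov-ndnio2-unc-3-g7-0`). Nothing restated: the law is hubbard-cov-ndnio2-box-1's `TPrimePinnedPair{,Family}RowWN.bundleWN_interior / _vertex /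
_vertex'` (`Downfold/BoxReadPinnedPairTPrime{,Family}.lean`, p662147 / p662965), the re-key identities are `….reprice` (ibid.) and `….refloor` (hubbard-cov-la214-box-2,
`Downfold/BoxesLa214V115M2cKernelPairCloser.lean`, p670727), the constant-objective chord is hubbard-cov-la214-unc-2's `tPrimeObj_chord_const`.

WHAT THIS FILE ADDS (one theorem, no definition): **`TPrimePinnedPairFamilyRowWN.bundleWN_ofKind`** (objective-FAMILY edition; a constant-objective pair
`h : TPrimePinnedPairRowWN … X₀` uses it as `h.toFamily.bundleWN_ofKind … (tPrimeObj_chord_const X₀ s_A s_B) hkind`) — from ONE pair row with ANY literals, `0 ≤ U`, `s_A < s_B`, a RATIONAL segment length (`hΔs : s_B − s_A = Δs`), `κ ≥ 0` ×4, a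
target window `[lo, hi]`, a slot `F` and a box constant `L` with the kernel cross constants in exact-ℚ form `(16211390/10⁷)·Δs·(±Δκ) ≤ L`, and ONE of the three floor
kinds as a DECIDABLE DISJUNCTION — INTERIOR `0 < L ∧ F ≤ β″_A − (L − (β″_B − β″_A))²/(4L)` ∣ VERTEX hub-binding `0 ≤ L ∧ β″_A + L ≤ β″_B ∧ F ≤ β″_A` ∣ VERTEX spoke-binding
`0 ≤ L ∧ β″_B + L ≤ β″_A ∧ F ≤ β″_B`, where `β″_v = β_v − κ_v·(hi − cap_v) − κ_v′·(fl_v − lo)` is the vertex bound re-keyed to the window — the bundle row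
`TPrimeBundleOrbitLowerRowWN U s_A s_B lo hi F sl_A sl_B n₀ X`. Every hypothesis after the pair (and, for the family edition, the objective chord `hX`) is a `norm_num`
fact once the literals are known, so a shape-level closer can take «pair + kind disjunct + prices» and leave the choice of kind to the instance (a claim node today, a
kernel-pair certificate tomorrow) without committing to it in its statement. Consumers: `Theorems/CovNdNiO2M21ItemsOfPairRows.lean` (this seat), and any later socket. The constant-objective special case already landed file-locally as
`Theorems.pinnedPairWN_bundleRow_of_kind` inside `Theorems/CovNdNiO2M22ItemsOfPairRows.lean` (p699850), a module that imports the M22 route file; this FAMILY edition is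
the ROUTE-INDEPENDENT home of the step (filed on the gate's `lint.theses-cone` advice: later sockets import no route file, and the gate's dedup rule forbids restating the
constant case).

HONEST FRAMING: solver-free plumbing of a CLAIM SHAPE justified outside Lean (two certsdp duals + pinfold + `D₄`/translation averaging) — NOT an SDP soundness theorem;
nothing is asserted or evaluated here; no node, number of record, registry row, word, margin, tier or hold changes. One-sided stiffness CEILINGS of CONTROL / CALIBRATION
class (xx1) on SCREENING-GRADE downfolded boxes; a ceiling never speaks to the presence or absence of superconductivity; no `T_c` / phase sentence; no item, rung leaf or
summit statement is proved here. Zero compute, no `sorry`.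

References: S. Boyd, L. Vandenberghe, *Convex Optimization* (2004) §5.9 [BoydVandenberghe2004]; E. H. Lieb, M. Loss, Duke Math. J. 71 (1993) 337, §8 Thm. 8.2
[LiebLoss1993]; T. Koma, H. Tasaki, J. Stat. Phys. 76 (1994) 745, §1 [KomaTasaki1994].
-/

noncomputable section

namespace Summit.Ventures.CertifiedManyBodySolver.Downfold

open Set Filter Topology
open Literature.MathematicalPhysics.QuantumLattice Literature.MathematicalPhysics.QuantumLattice.ThermodynamicLimit
open Literature.MathematicalPhysics.QuantumLattice.InfVolFermionState
open Literature.Probability.LatticeModels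

section Kind

variable {U sA sB : ℝ} {cA cB flA flB βA κA κA' slA βB κB κB' slB n₀ : ℚ}
  {X : ℝ → FermionOp (Literature.Probability.LatticeModels.box 2 7)}

/-- **FAMILY PAIR ROW ⟹ BUNDLE ROW AT THE WINDOW `[lo, hi]`, ANY FLOOR KIND.** Re-key the pair to the window (`reprice` to `hi`, `refloor` to `lo`; the vertex bounds
become `β″_v = β_v − κ_v·(hi − cap_v) − κ_v′·(fl_v − lo)`), cast the exact-ℚ cross constants against the rational segment length `Δs`, then the boxdual covariance law
in whichever of its three kinds the DECIDABLE disjunction `hkind` names (`bundleWN_interior` ∣ `bundleWN_vertex` ∣ `bundleWN_vertex'`), under the objective chord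
hypothesis `hX` of the family law. [cite: BoydVandenberghe2004, §5.9] [cite: LiebLoss1993, §8, Theorem 8.2] -/
theorem TPrimePinnedPairFamilyRowWN.bundleWN_ofKind
    (h : TPrimePinnedPairFamilyRowWN U sA sB cA cB flA flB βA κA κA' slA βB κB κB' slB n₀ X)
    (hU : 0 ≤ U) (hAB : sA < sB) (Δs : ℚ) (hΔs : sB - sA = ((Δs : ℚ) : ℝ))
    (hκA : 0 ≤ κA) (hκA' : 0 ≤ κA') (hκB : 0 ≤ κB) (hκB' : 0 ≤ κB')
    (lo hi F L : ℚ)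
    (hL₁ : (16211390 / 10000000 : ℚ) * Δs * (κA - κA' - (κB - κB')) ≤ L)
    (hL₂ : (16211390 / 10000000 : ℚ) * Δs * -(κA - κA' - (κB - κB')) ≤ L)
    (hX : ∀ ω : InfVolFermionState 2, ω.IsTranslationInvariant → ∀ s ∈ Set.Icc sA sB,
      (sB - s) * tPrimeObjOrbitMean X sA ω + (s - sA) * tPrimeObjOrbitMean X sB ω ≤ (sB - sA) * tPrimeObjOrbitMean X s ω)
    (hkind : (0 < L ∧ F ≤ (βA - κA * (hi - cA) - κA' * (flA - lo)) -
          (L - ((βB - κB * (hi - cB) - κB' * (flB - lo)) - (βA - κA * (hi - cA) - κA' * (flA - lo)))) ^ 2 / (4 * L)) ∨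
      (0 ≤ L ∧ (βA - κA * (hi - cA) - κA' * (flA - lo)) + L ≤ (βB - κB * (hi - cB) - κB' * (flB - lo)) ∧
          F ≤ βA - κA * (hi - cA) - κA' * (flA - lo)) ∨
      (0 ≤ L ∧ (βB - κB * (hi - cB) - κB' * (flB - lo)) + L ≤ (βA - κA * (hi - cA) - κA' * (flA - lo)) ∧
          F ≤ βB - κB * (hi - cB) - κB' * (flB - lo))) :
    TPrimeBundleOrbitLowerRowWN U sA sB lo hi F slA slB n₀ X := by
  -- (1) re-key both vertices to the window (identities of the pair)
  have h1 := (h.reprice hi hi).refloor lo lo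
  -- (2) the kernel cross constants, cast to `ℝ` against the real segment length
  have e : (1.6211390 : ℝ) * (sB - sA) = (((16211390 / 10000000 : ℚ) * Δs : ℚ) : ℝ) := by
    rw [hΔs]; push_cast; norm_num
  have hL₁' : (1.6211390 : ℝ) * (sB - sA) * (((κA - κA' - (κB - κB') : ℚ)) : ℝ) ≤ ((L : ℚ) : ℝ) := by
    rw [e, ← Rat.cast_mul]; exact (Rat.cast_le (K := ℝ)).2 hL₁
  have hL₂' : (1.6211390 : ℝ) * (sB - sA) * -(((κA - κA' - (κB - κB') : ℚ)) : ℝ) ≤ ((L : ℚ) : ℝ) := by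
    rw [e, ← Rat.cast_neg, ← Rat.cast_mul]; exact (Rat.cast_le (K := ℝ)).2 hL₂
  -- (3) the law in the named kind
  rcases hkind with ⟨hL0, hF⟩ | ⟨hL0, hg, hF⟩ | ⟨hL0, hg, hF⟩
  · exact h1.bundleWN_interior hU hAB hκA hκA' hκB hκB' le_rfl le_rfl le_rfl le_rfl hL₁' hL₂' hX hL0 hF
  · exact h1.bundleWN_vertex hU hAB hκA hκA' hκB hκB' le_rfl le_rfl le_rfl le_rfl hL₁' hL₂' hX hL0 hg hF
  · exact h1.bundleWN_vertex' hU hAB hκA hκA' hκB hκB' le_rfl le_rfl le_rfl le_rfl hL₁' hL₂' hX hL0 hg hF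

end Kind

end Summit.Ventures.CertifiedManyBodySolver.Downfold

end
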